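import Summits.BirchSwinnertonDyer.BirchSwinnertonDyer.Theses.KolyvaginRankRigidityAtTwo
import Summits.BirchSwinnertonDyer.BirchSwinnertonDyer.Theorems.KolyvaginRankRigidityAtTwoWalkEngineAdapter
import Literature.NumberTheory.EllipticCurves.CasselsTateSelmerKolyvaginValue
import Literature.NumberTheory.EllipticCurves.HeegnerPointsKolyvaginConjugation
import Summits.BirchSwinnertonDyer.BirchSwinnertonDyer.Theorems.KolyvaginRankRigidityAtTwoChebotarevWindowPrimeAtTwo
import Summits.BirchSwinnertonDyer.BirchSwinnertonDyer.Theorems.KolyvaginRankRigidityAtTwoWalkStepTransfer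
import Summits.BirchSwinnertonDyer.BirchSwinnertonDyer.Theorems.KolyvaginRankRigidityAtTwoSwapFromPiecesPrelims
import Summits.BirchSwinnertonDyer.BirchSwinnertonDyer.Theorems.Rank1ResidualJetCompatibleData
import Summits.BirchSwinnertonDyer.BirchSwinnertonDyer.Theorems.Rank1ResidualJetRingClassFields
import Summits.BirchSwinnertonDyer.BirchSwinnertonDyer.Theorems.ByReductionTypeAtTwoRankOneAtTwoOffBigImageOddLocalEngineEndToEnd
import Literature.NumberTheory.EllipticCurves.Jetchev2008.CoreVertices
import Summits.BirchSwinnertonDyer.BirchSwinnertonDyer.Theorems.KolyvaginRankRigidityAtTwoRegularCoreSupplyAtTwoRegularConductors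
import Summits.BirchSwinnertonDyer.BirchSwinnertonDyer.Theorems.KolyvaginRankRigidityAtTwoWalkNearCore
import Summits.BirchSwinnertonDyer.BirchSwinnertonDyer.Theorems.KolyvaginRankRigidityAtTwoStartFrameOfParity
import Summits.BirchSwinnertonDyer.BirchSwinnertonDyer.Theorems.KolyvaginRankRigidityAtTwoStartFrameNearCoreHolds
import Summits.BirchSwinnertonDyer.BirchSwinnertonDyer.Theorems.GenusKolyvaginAtTwoKolyvaginRelationAtTwo
import Summits.BirchSwinnertonDyer.BirchSwinnertonDyer.Theorems.GenusKolyvaginAtTwoVisiblePairAtTwoKolyvaginClassSign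
import Summits.BirchSwinnertonDyer.BirchSwinnertonDyer.Theorems.KolyvaginRankRigidityAtTwoWalkBridge
import Summits.BirchSwinnertonDyer.BirchSwinnertonDyer.Theorems.KolyvaginRankRigidityAtTwoSwapOfNamedFacts
import Summits.BirchSwinnertonDyer.BirchSwinnertonDyer.Theorems.KolyvaginRankRigidityAtTwoSwapPairingLowerBoundGlobalOfIndex
import Summits.BirchSwinnertonDyer.BirchSwinnertonDyer.Theorems.GenusKolyvaginAtTwoPowDvdShaCardAtTwoRTKolyvaginClassLevels
import Summits.BirchSwinnertonDyer.BirchSwinnertonDyer.Theorems.KolyvaginRankRigidityAtTwoRegularValueEngineTwoLevel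
import Summits.BirchSwinnertonDyer.BirchSwinnertonDyer.Theorems.KolyvaginRankRigidityAtTwoSignedRefillSupplyAtTwo
import Summits.BirchSwinnertonDyer.BirchSwinnertonDyer.Theorems.KolyvaginRankRigidityAtTwoOppositeSignReciprocityAtTwo
import Summits.BirchSwinnertonDyer.BirchSwinnertonDyer.Theorems.KolyvaginRankRigidityAtTwoStartShapeAtTwo
import Summits.BirchSwinnertonDyer.BirchSwinnertonDyer.Theorems.KolyvaginRankRigidityAtTwoLevelDropAtTwo
import Summits.BirchSwinnertonDyer.BirchSwinnertonDyer.Theorems.KolyvaginRankRigidityAtTwoShapeRefillAtTwo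
import Summits.BirchSwinnertonDyer.BirchSwinnertonDyer.Theorems.Rank1ResidualJetCompatibleDataDown
import Summits.BirchSwinnertonDyer.BirchSwinnertonDyer.Theorems.GenusKolyvaginAtTwoPowDvdShaCardAtTwoRTKolyvaginClassOrder
import Summits.BirchSwinnertonDyer.BirchSwinnertonDyer.Theorems.KolyvaginRoadThreeLevelData
import Summits.BirchSwinnertonDyer.Rank1Residual.X11b.Three.KolyvaginNonvanishing
import Literature.NumberTheory.EllipticCurves.HeegnerPointsOfConductorRationalityProofs
import Literature.NumberTheory.EllipticCurves.RingClassGalOverCyclicProofs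
import Summits.BirchSwinnertonDyer.BirchSwinnertonDyer.Theorems.KolyvaginRankRigidityAtTwoLoneSeedPartnerAtTwo
import Summits.BirchSwinnertonDyer.BirchSwinnertonDyer.Theorems.KolyvaginRankRigidityAtTwoKolyvaginSwapDefs
import Summits.BirchSwinnertonDyer.BirchSwinnertonDyer.Theorems.KolyvaginRankRigidityAtTwoKolyvaginSwapVertical
import HarnessLib

/-!
# Crux U1 `KolyvaginBoundedDefectAtTwo` (stmt-BirchSwinnertonDyer-28083), LINE 17 `kolyvagin_swap` — THE COMPOSITION LANDED:
# U1 ⟸ S0ʳ (Kolyvagin's conjecture at 2 in room form, the line's INPUT) + Gross 1991 Prop. 3.7 (2) (the line's one PRINT fact)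

Width seat `bsd-line-krr2-p2` g19 (ONE READER on LINE 17); `--supports stmt-BirchSwinnertonDyer-28083` (helper).  The proof texts are the pen
`bsd-idea-1`'s v8.5 kernel (HOME `line17/kolyvagin_swap_v85_UNCHECKED.lean` sha16 1a50902741cceb1e §4–§6), VERBATIM up to feeding the pieces BY
NAME from the tree: LD `RegularWalk.levelDropAtTwo` (p727017), START `RegularWalk.startShapeAtTwo` (p725345), SWα⁗ mod P372
`KolyvaginSwap.shedSeedPrimeShapedAtTwo_of_frobeniusCongruence` (…ShedSeedPrimeShapedAtTwo), Zζ mod P372 `RegularWalk.loneSeedPartnerAtTwo_of_frobeniusCongruence`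
(p726904), Q2 mod P372 `GenusExact.kolyvaginRelationAtTwo_of_frobeniusCongruence` (GK2, p614530), VG `KolyvaginSwap.verticalGrowthAtTwo_holds`;
the sign law and EV (margin-one form) are proved here.

MAIN THEOREM (here, SWα⁗ as a hypothesis) `kolyvaginBoundedDefectAtTwo_of_roomSeed_of_shedSeed :
  KolyvaginRoomSeedAtTwo → ShedSeedPrimeShapedAtTwo → GrossLMS1991.prop37_2_frobeniusCongruence → KolyvaginBoundedDefectAtTwo`;
the plugged form `…_of_roomSeed_of_frobeniusCongruence : S0ʳ → P372 → U1` is the one-liner of `…KolyvaginSwapComposition` (SWα⁗ =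
`KolyvaginSwap.shedSeedPrimeShapedAtTwo_of_frobeniusCongruence`, p738438; split off only because that module's olean lags on the farm).
HONEST FRAMING: this is a CONDITIONAL theorem.  `KolyvaginRoomSeedAtTwo` (S0ʳ, `@[conjecture]` in `…KolyvaginSwapDefs`) is Kolyvagin's conjecture
at 2 in room form — OPEN, an input, never a fact; `prop37_2_frobeniusCongruence` is a named Literature fact (Gross 1991 Prop. 3.7 (2) /
Nekovář 2007 Prop. 4.9), unproved in the tree (its Eichler–Shimura step is the documented wall).  The crux item U1 is therefore NOT closed by
this file; what it records is that LINE 17's swap machinery (regular engine primes, signed refill law, opposite-sign reciprocity, the shaped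
walk) reduces U1 to exactly {S0ʳ, P372} in the kernel.  No rung, no summit: **BSD is NOT proved.**

## The chain (pen's card `line17/kolyvagin_swap_v7.md` §v7.4–§v8.5)
`boundedDefect_of_deepSeed : DeepSeedAtTwo → U1` (vertical growth) ∘ `deepSeedAtTwo_of_swap : S0ʳ → LD → START → SW⁗ → DeepSeedAtTwo` (the
shaped walk `walk`, room bookkeeping `room`) ∘ `seedPrimeSwapShapedAtTwo_of : SWα⁗ → Zζ → Q2 → EV → SW⁗`.
References (locators only; no cited FACT is declared here): [cite: Kolyvagin1991MathAnn, §2] [cite: Kolyvagin1991StructureSha, Prop. 8]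
[cite: MazurRubin2004, §4.1] [cite: GrossLMS1991, §3 Prop. 3.7 (2), §9] [cite: McCallumLMS1991, §4 Prop. 4.4, Cor. 4.5, §5].
Design: no definitions; `K : Type`; axioms `propext`, `Classical.choice`, `Quot.sound`.
-/

set_option autoImplicit false
-- the Theorems namespace of this sub repeats the summit name by design (D-0017 nested layout)
set_option linter.dupNamespace false

noncomputable section

open scoped Classical
open WeierstrassCurve NumberField IsDedekindDomain Field
open Literature.NumberTheory.GaloisRepresentations Literature.NumberTheory.EllipticCurves Literature.NumberTheory
open Literature.NumberTheory.EllipticCurves.ModularForms Literature.NumberTheory.EllipticCurves.KolyvaginCocycle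
open Rat.HeightOneSpectrum
open Summit.BirchSwinnertonDyer.Rank1Residual.X11b
open Summit.BirchSwinnertonDyer.BirchSwinnertonDyer.Theorems
open Summit.BirchSwinnertonDyer.BirchSwinnertonDyer.Theorems.GenusExact.PlusDescent
open Summit.BirchSwinnertonDyer.BirchSwinnertonDyer.Theses.KolyvaginRankRigidityAtTwo

namespace Summit.BirchSwinnertonDyer.BirchSwinnertonDyer.Theorems.KolyvaginAtTwo.KolyvaginSwap

/-! ### §1 DEEP SEED ⟹ U1 (vertical growth) -/

/-- **DEEP SEED ⟹ U1** (`r := r`, `m := M₁ − 1`; the order bound is vertical growth `verticalGrowthAtTwo_holds`). -/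
theorem boundedDefect_of_deepSeed (h : DeepSeedAtTwo) : KolyvaginBoundedDefectAtTwo := by
  intro W _ _ hCM hred hsurj K _ _ hK _ hH hodd hd3 htors hH2 Dt β ι hβ
  obtain ⟨r, M₁, hM₁, hdeep⟩ := h W hCM hred hsurj K hK hH hodd hd3 htors hH2 Dt β ι hβ
  refine ⟨r, M₁ - 1, fun M hM ↦ ?_⟩
  obtain ⟨n, d, hKol, hcard, hidx, hseed⟩ := hdeep M (by omega)
  refine ⟨n, d, hKol, hcard, hidx, ?_⟩
  have hMm : M - (M₁ - 1) - 1 = M - M₁ := by omega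
  rw [hMm]
  exact verticalGrowthAtTwo_holds W hsurj K hK hH hodd hd3 Dt β ι n d M₁ M hKol hidx (by omega) hseed

/-! ### §2 The sign law and EV (margin one), kernel -/

/-- KERNEL: the sign law at 2 holds (tree theorem `sign_conjAct_kolyvaginClass_two`; `d_K` odd ⟹ `d_K ≠ −4`; `ρ̄_{E,2}` onto from `∀ m`;
the index clause `M ≤ M(ℓ)` for `ℓ ∣ n` from `M ≤ M(n)` by `Zhang2014.natCast_le_levelIndex_iff`). -/
theorem kolyvaginClassSignAtTwo_holds : KolyvaginClassSignAtTwo := by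
  intro W _ _ hCM hred hsurj K _ _ hK _ hH hodd hd3 htors hH2 Dt β ι _ hβ τ hτ1 n M d hKol hM hidx
  have hD4 : NumberField.discr K ≠ -4 := by
    intro h4
    rw [h4] at hodd
    have := Int.odd_iff.mp hodd
    omega
  have h2 : W.HasSurjectiveModNGaloisRep ((2 : ℤ) ^ 1) := by simpa using hsurj 1
  have hnK : ∀ ℓ ∈ n.primeFactors, Literature.NumberTheory.EllipticCurves.Zhang2014.IsKolyvaginPrime (W.conductorNorm ℤ) W K 2 ℓ ∧
      M ≤ Literature.NumberTheory.EllipticCurves.Zhang2014.kolyvaginIndex W 2 ℓ :=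
    fun ℓ hℓ ↦ ⟨hKol.2 ℓ hℓ, Zhang2014.natCast_le_levelIndex_iff.mp hidx ℓ hℓ⟩
  obtain ⟨hu, hc⟩ :=
    Summit.BirchSwinnertonDyer.BirchSwinnertonDyer.Theorems.GenusExact.KolyvaginClassSign.sign_conjAct_kolyvaginClass_two
      hK hd3 hD4 hodd hH h2 τ hτ1 Dt β ι hKol.1 hM hnK d
  exact ⟨_, hu, hc⟩

/-- **EV holds** (kernel, sorry-free). -/
theorem singularToVisibleAtTwo_holds : SingularToVisibleAtTwo := by
  intro W _ _ hCM hred hsurj K _ _ hK _ hH hodd hd3 htors hH2 Dt β ι _ hβ M q j x hKol hidx w hw hnot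
  by_contra hvis
  push Not at hvis
  apply hnot
  rw [KolyvaginLowerBoundAtTwo.mem_torsionLocalKer_two_pow_iff W M w]
  have hle : torsionFixing (W.baseChange K) ((2 ^ (M + 1) : ℕ) : ℤ) ≤ torsionFixing (W.baseChange K) ((2 ^ M : ℕ) : ℤ) :=
    KolyvaginLowerBoundAtTwo.torsionFixing_le_of_dvd _ (KolyvaginAtTwo.RegularValueEngine.natCast_two_pow_dvd_succ M)
  refine KolyvaginAtTwo.RegularRefill.localization_eq_zero_of_forall_h1Eval_eq_zero W hK hKol hidx w hw fun ρ hρ ↦ ?_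
  rw [h1Eval_zsmul _ _ _ _ (hle hρ)]
  exact hvis ρ (hle hρ)

/-! ### §3 THE CUT: SWα⁗ + Zζ + Q2 + EV ⟹ SW⁗ -/

/-- **THE CUT (kernel, v7.5/v7.7): SWα⁗ (main case `1 ≤ t ∨ 2 ≤ #s`) + Zζ (corner `t = 0 ∧ #s ≤ 1` vacuous; v7.7: itself derived from OSR + SRS) + Q2-at-2 + EV (v7.7: proved) ⟹ SW⁗**, with the loss
function `κ_SW a := max (κ_α a) (κ₀ a)` and visibility monotone in the exponent (`KolyvaginLowerBoundAtTwo.two_pow_zsmul_ne_zero_of_le_swap`). -/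
theorem seedPrimeSwapShapedAtTwo_of (hα : ShedSeedPrimeShapedAtTwo) (hZ : LoneSeedPartnerAtTwo)
    (hQ2 : Summit.BirchSwinnertonDyer.BirchSwinnertonDyer.Theses.GenusKolyvaginAtTwo.KolyvaginRelationAtTwo)
    (hEV : SingularToVisibleAtTwo) : SeedPrimeSwapShapedAtTwo := by
  intro W _ _ hCM hred hsurj K _ _ hK _ hH hodd hd3 htors hH2 Dt β ι _ hβ τ hτ u hu
  obtain ⟨κ, g, hshed⟩ := hα W hCM hred hsurj K hK hH hodd hd3 htors hH2 Dt β ι hβ τ hτ u hu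
  obtain ⟨κ₀, hlone⟩ := hZ W hCM hred hsurj K hK hH hodd hd3 htors hH2 Dt β ι hβ τ hτ u hu
  have hev := hEV W hCM hred hsurj K hK hH hodd hd3 htors hH2 Dt β ι hβ
  have hd4 : NumberField.discr K ≠ -4 := by
    intro h4
    obtain ⟨k, hk⟩ := hodd
    omega
  refine ⟨fun a ↦ max (κ a) (κ₀ a), g, fun a t I M v s e d hKol hs1 hM hMI hidx hdeep hshape hsign hvis ↦ ?_⟩
  obtain ⟨ρ, hρ, hvisρ⟩ := hvis
  by_cases h01 : 1 ≤ t ∨ 2 ≤ s.primeFactors.card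
  · have hvisα : ∃ ρ ∈ torsionFixing (W.baseChange K) ((2 ^ M : ℕ) : ℤ),
        ((2 ^ (v + κ a) : ℕ) : ℤ) • h1Eval (W.baseChange K) ((2 ^ M : ℕ) : ℤ) (d.kolyvaginClass Nat.prime_two M) ρ ≠ 0 :=
      ⟨ρ, hρ, KolyvaginLowerBoundAtTwo.two_pow_zsmul_ne_zero_of_le_swap (Nat.add_le_add_left (le_max_left (κ a) (κ₀ a)) v) hvisρ⟩
    obtain ⟨q, s', f, t', d', hsq, hq, hdeepf, hcard', hcardn, hKol', hidx', hshape', hsign', dup, hsqf, hqm, hall, hcσ, hcS₁,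
      hcS₂, hcemb, w, hw, hnotSel⟩ := hshed a t I M v s e d hKol hs1 hM hMI hidx hdeep hshape h01 hsign hvisα
    refine ⟨q, s', f, t', d', hsq, hq, hdeepf, hcard', hcardn, hKol', hidx', hshape', hsign', ?_⟩
    have hrel := hQ2 W hCM K hK hd3 hd4 hH hsurj Dt β ι M hM (s' * (e * f)) q hsqf hq hqm hall d' dup hcσ hcS₁ hcS₂ hcemb w hw v
    have hnotTors : ((2 ^ v : ℕ) : ℤ) • dup.kolyvaginClass Nat.prime_two M ∉
        (W.baseChange K).torsionLocalKer (w.adicCompletion K) ((2 ^ M : ℕ) : ℤ) := fun h ↦ hnotSel (hrel.1.mpr h)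
    have hnotTors' : ((2 ^ v : ℕ) : ℤ) • d'.kolyvaginClass Nat.prime_two M ∉
        (W.baseChange K).torsionLocalKer (w.adicCompletion K) ((2 ^ M : ℕ) : ℤ) := fun h ↦ hnotTors (hrel.2.mpr h)
    have hqse : q ∈ (s * e).primeFactors :=
      Nat.mem_primeFactors.mpr ⟨hq, Dvd.intro (s' * e) (by rw [hsq]; ring), hKol.1.ne_zero⟩
    exact hev M q v (d'.kolyvaginClass Nat.prime_two M) (hKol.2 q hqse) (Zhang2014.natCast_le_levelIndex_iff.mp hidx q hqse) w hw
      hnotTors'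
  · -- the corner `t = 0 ∧ #s ≤ 1`: vacuous by Zζ
    exfalso
    have ht : ¬ 1 ≤ t := fun h ↦ h01 (Or.inl h)
    have hs : ¬ 2 ≤ s.primeFactors.card := fun h ↦ h01 (Or.inr h)
    have ht0 : t = 0 := by omega
    subst ht0
    exact hlone a I M s e d hKol hs1 (by omega) hM hMI hidx hdeep hshape hsign
      ⟨ρ, hρ, KolyvaginLowerBoundAtTwo.two_pow_zsmul_ne_zero_of_le_swap (le_trans (le_max_right (κ a) (κ₀ a)) (Nat.le_add_left _ v)) hvisρ⟩

/-! ### §4 The shaped walk and {S0ʳ, LD, START, SW⁗} ⟹ DeepSeedAtTwo -/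

/-- THE SHAPED WALK (kernel): with room `room κ g a #(seed primes)` the seed primes are shed one at a time (strong induction on their number),
threading the level `M`, MARGIN ONE, the deep-index/regularity invariant of the engine part, the number of prime factors, the exact sign `u`
of the walking class and the SHAPE of the `(−u)`-part of the engine Selmer group (error `a ↦ g a`); at the end the conductor is all engine primes
(index `≥ M*`) and the class at the FIXED level is visibly non-zero, hence non-zero (`h1Eval_zero`). -/
theorem walk (W : WeierstrassCurve ℚ) [W.IsElliptic] [W.IsGloballyMinimal] {K : Type} [Field K] [NumberField K] [NeZero (W.conductorNorm ℤ)]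
    {Dt : Literature.NumberTheory.EllipticCurves.ModularForms.ModularParametrizationData W (W.conductorNorm ℤ)} {β : ℤ} {ι : K →+* ℂ}
    [∀ k : ℕ, NumberField (ringClassField K ι k)] {κ g : ℕ → ℕ} {M Mstar r : ℕ} {τ : K ≃ₐ[ℚ] K} {u : ℤ}
    (hM : 1 ≤ M) (hMstar : M + 1 ≤ Mstar)
    (hswap : ∀ (a t I N v s e : ℕ) (d : Literature.NumberTheory.EllipticCurves.KolyvaginHeegnerData Dt β ι (s * e)),
      Literature.NumberTheory.EllipticCurves.KolyvaginDescent.KolSupp (Literature.NumberTheory.EllipticCurves.Zhang2014.IsKolyvaginPrime (W.conductorNorm ℤ) W K 2) (s * e) →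
      s ≠ 1 → 1 ≤ N → N + 1 ≤ I → (((N + 1 : ℕ) : ℕ) : ℕ∞) ≤ Literature.NumberTheory.EllipticCurves.Zhang2014.levelIndex W 2 (s * e) →
      (∀ p ∈ (e).primeFactors, I ≤ Literature.NumberTheory.EllipticCurves.Zhang2014.kolyvaginIndex W 2 p ∧ (∃ (pl : HeightOneSpectrum (𝓞 ℚ)) (𝔓 : Ideal (absIntegers (𝓞 ℚ) ℚ)) (h : absoluteGaloisGroup ℚ), (p : 𝓞 ℚ) ∈ pl.asIdeal ∧ 𝔓 ∈ pl.primesAbove ∧ IsArithFrobAt (𝓞 ℚ) h 𝔓 ∧ (∀ X : geomTorsion W ((2 ^ N : ℕ) : ℤ), h • h • X = X) ∧ ∃ P : geomTorsion W ((2 ^ N : ℕ) : ℤ), (2 : ℤ) ^ (N - 1) • (P + h • P) ≠ 0)) →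
      OppShape W K ι τ N e u a t →
      conjAct W τ ((2 ^ N : ℕ) : ℤ) (d.kolyvaginClass Nat.prime_two N) = u • d.kolyvaginClass Nat.prime_two N →
      (∃ ρ ∈ torsionFixing (W.baseChange K) ((2 ^ N : ℕ) : ℤ),
          ((2 ^ (v + κ a) : ℕ) : ℤ) • h1Eval (W.baseChange K) ((2 ^ N : ℕ) : ℤ) (d.kolyvaginClass Nat.prime_two N) ρ ≠ 0) →
      ∃ (q s' f t' : ℕ) (d' : Literature.NumberTheory.EllipticCurves.KolyvaginHeegnerData Dt β ι (s' * (e * f))),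
        s = q * s' ∧ q.Prime ∧
        (∀ p ∈ (e * f).primeFactors, I ≤ Literature.NumberTheory.EllipticCurves.Zhang2014.kolyvaginIndex W 2 p ∧ (∃ (pl : HeightOneSpectrum (𝓞 ℚ)) (𝔓 : Ideal (absIntegers (𝓞 ℚ) ℚ)) (h : absoluteGaloisGroup ℚ), (p : 𝓞 ℚ) ∈ pl.asIdeal ∧ 𝔓 ∈ pl.primesAbove ∧ IsArithFrobAt (𝓞 ℚ) h 𝔓 ∧ (∀ X : geomTorsion W ((2 ^ N : ℕ) : ℤ), h • h • X = X) ∧ ∃ P : geomTorsion W ((2 ^ N : ℕ) : ℤ), (2 : ℤ) ^ (N - 1) • (P + h • P) ≠ 0)) ∧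
        s'.primeFactors.card + 1 = s.primeFactors.card ∧
        (s' * (e * f)).primeFactors.card = (s * e).primeFactors.card ∧
        Literature.NumberTheory.EllipticCurves.KolyvaginDescent.KolSupp (Literature.NumberTheory.EllipticCurves.Zhang2014.IsKolyvaginPrime (W.conductorNorm ℤ) W K 2) (s' * (e * f)) ∧
        (((N + 1 : ℕ) : ℕ) : ℕ∞) ≤ Literature.NumberTheory.EllipticCurves.Zhang2014.levelIndex W 2 (s' * (e * f)) ∧
        OppShape W K ι τ N (e * f) u (g a) t' ∧
        conjAct W τ ((2 ^ N : ℕ) : ℤ) (d'.kolyvaginClass Nat.prime_two N) = u • d'.kolyvaginClass Nat.prime_two N ∧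
        (∃ ρ ∈ torsionFixing (W.baseChange K) ((2 ^ N : ℕ) : ℤ),
          ((2 ^ (v) : ℕ) : ℤ) • h1Eval (W.baseChange K) ((2 ^ N : ℕ) : ℤ) (d'.kolyvaginClass Nat.prime_two N) ρ ≠ 0))
    :
    ∀ (j : ℕ) (a t s e v n : ℕ) (d : Literature.NumberTheory.EllipticCurves.KolyvaginHeegnerData Dt β ι n), n = s * e →
      s.primeFactors.card ≤ j →
      Literature.NumberTheory.EllipticCurves.KolyvaginDescent.KolSupp (Literature.NumberTheory.EllipticCurves.Zhang2014.IsKolyvaginPrime (W.conductorNorm ℤ) W K 2) (n) →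
      n.primeFactors.card = r → (((M + 1 : ℕ) : ℕ) : ℕ∞) ≤ Literature.NumberTheory.EllipticCurves.Zhang2014.levelIndex W 2 (n) →
      (∀ p ∈ (e).primeFactors, Mstar ≤ Literature.NumberTheory.EllipticCurves.Zhang2014.kolyvaginIndex W 2 p ∧ (∃ (pl : HeightOneSpectrum (𝓞 ℚ)) (𝔓 : Ideal (absIntegers (𝓞 ℚ) ℚ)) (h : absoluteGaloisGroup ℚ), (p : 𝓞 ℚ) ∈ pl.asIdeal ∧ 𝔓 ∈ pl.primesAbove ∧ IsArithFrobAt (𝓞 ℚ) h 𝔓 ∧ (∀ X : geomTorsion W ((2 ^ M : ℕ) : ℤ), h • h • X = X) ∧ ∃ P : geomTorsion W ((2 ^ M : ℕ) : ℤ), (2 : ℤ) ^ (M - 1) • (P + h • P) ≠ 0)) →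
      OppShape W K ι τ M e u a t →
      conjAct W τ ((2 ^ M : ℕ) : ℤ) (d.kolyvaginClass Nat.prime_two M) = u • d.kolyvaginClass Nat.prime_two M →
      room κ g a s.primeFactors.card ≤ v →
      (∃ ρ ∈ torsionFixing (W.baseChange K) ((2 ^ M : ℕ) : ℤ),
          ((2 ^ (v) : ℕ) : ℤ) • h1Eval (W.baseChange K) ((2 ^ M : ℕ) : ℤ) (d.kolyvaginClass Nat.prime_two M) ρ ≠ 0) →
      ∃ (n' : ℕ) (d' : Literature.NumberTheory.EllipticCurves.KolyvaginHeegnerData Dt β ι n'),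
        Literature.NumberTheory.EllipticCurves.KolyvaginDescent.KolSupp (Literature.NumberTheory.EllipticCurves.Zhang2014.IsKolyvaginPrime (W.conductorNorm ℤ) W K 2) (n') ∧
        n'.primeFactors.card = r ∧ ((Mstar : ℕ) : ℕ∞) ≤ Literature.NumberTheory.EllipticCurves.Zhang2014.levelIndex W 2 n' ∧
        d'.kolyvaginClass Nat.prime_two M ≠ 0 := by
  intro j
  induction j with
  | zero =>
    intro a t s e v n d hn hj hKol hcard hidx hdeep _ _ _ hvis
    have hs0 : s.primeFactors = ∅ := Finset.card_eq_zero.mp (Nat.le_zero.mp hj)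
    rcases Nat.primeFactors_eq_empty.mp hs0 with h0 | h1
    · exfalso
      subst h0
      have h00 : n = 0 := by rw [hn, Nat.zero_mul]
      exact (hKol.1.ne_zero) h00
    · subst h1
      have hne : n = e := by rw [hn, Nat.one_mul]
      refine ⟨n, d, hKol, hcard, ?_, ?_⟩
      · exact Zhang2014.natCast_le_levelIndex_iff.mpr fun p hp ↦ (hdeep p (by rw [← hne]; exact hp)).1
      · obtain ⟨ρ, hρ, hval⟩ := hvis
        intro hc
        apply hval
        rw [hc, h1Eval_zero _ _ hρ, smul_zero]
  | succ j ih =>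
    intro a t s e v n d hn hj hKol hcard hidx hdeep hshape hsign hv hvis
    by_cases hsj : s.primeFactors.card ≤ j
    · exact ih a t s e v n d hn hsj hKol hcard hidx hdeep hshape hsign hv hvis
    · have hcs : s.primeFactors.card = j + 1 := by omega
      have hs1 : s ≠ 1 := by
        rintro rfl
        simp [Nat.primeFactors_one] at hcs
      -- room: `κ a ≤ v` and the budget of the new state
      have hroom : room κ g a s.primeFactors.card = κ a + room κ g (g a) j := by rw [hcs]; rfl
      have hκv : κ a ≤ v := by rw [hroom] at hv; omega
      have hvis' : ∃ ρ ∈ torsionFixing (W.baseChange K) ((2 ^ M : ℕ) : ℤ),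
          ((2 ^ ((v - κ a) + κ a) : ℕ) : ℤ) • h1Eval (W.baseChange K) ((2 ^ M : ℕ) : ℤ) (d.kolyvaginClass Nat.prime_two M) ρ ≠ 0 := by
        rw [Nat.sub_add_cancel hκv]; exact hvis
      subst hn
      obtain ⟨q, s', f, t', d', hsq, hq, hdeep', hcard', hcardn', hKol', hidx', hshape', hsign', hvisℓ⟩ :=
        hswap a t Mstar M (v - κ a) s e d hKol hs1 hM hMstar hidx hdeep hshape hsign hvis'
      have hs'j : s'.primeFactors.card ≤ j := by omega
      have hcard'' : (s' * (e * f)).primeFactors.card = r := by rw [hcardn']; exact hcard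
      have hv' : room κ g (g a) s'.primeFactors.card ≤ v - κ a := by
        have h1 : s'.primeFactors.card = j := by omega
        rw [h1]; rw [hroom] at hv; omega
      exact ih (g a) t' s' (e * f) (v - κ a) (s' * (e * f)) d' rfl hs'j hKol' hcard'' hidx' hdeep' hshape' hsign' hv' hvisℓ

/-- **{S0ʳ, LD, START⁗, SW⁗} ⟹ DeepSeedAtTwo** (kernel).  ORDER OF CHOICES (the point of v7.4's bookkeeping): the complex conjugation `τ`;
from START⁗ the sign oracle and the uniform start error `a₀`; from SW⁗ the loss/shape functions for BOTH signs `u = ±1`; from S0ʳ the depth `r`;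
only THEN the room `R := max_u room(κ_u, g_u, a₀, r)` and a seed of visible order `> 2^{R+1}` at some level `M₁ ≤ M(n₁)`; LD drops to the
walk's level `M := M₁ − 1 ≥ 1` (margin one, visible order `> 2^R`); the sign `u` of the seed class picks the branch; the walk at target index
`M* + M + 1` sheds the `r`... seed primes and returns a conductor of `r` engine primes of index `≥ M*` with `c_M ≠ 0`. -/
theorem deepSeedAtTwo_of_swap (hS : KolyvaginRoomSeedAtTwo) (hLD : LevelDropAtTwo) (hT : StartShapeAtTwo)
    (hW : SeedPrimeSwapShapedAtTwo) : DeepSeedAtTwo := by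
  intro W _ _ hCM hred hsurj K _ _ hK _ hH hodd hd3 htors hH2 Dt β ι hβ
  haveI : ∀ k : ℕ, NumberField (ringClassField K ι k) :=
    Summit.BirchSwinnertonDyer.Rank1Residual.JET.numberField_ringClassField K hK ι
  obtain ⟨τ, hτ1⟩ := Summit.BirchSwinnertonDyer.Rank1Residual.JET.exists_algEquiv_ne_one_of_isImaginaryQuadratic K hK
  obtain ⟨a₀, hstart⟩ := hT W hCM hred hsurj K hK hH hodd hd3 htors hH2 Dt β ι hβ τ hτ1
  have hsign := kolyvaginClassSignAtTwo_holds W hCM hred hsurj K hK hH hodd hd3 htors hH2 Dt β ι hβ τ hτ1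
  obtain ⟨κ₁, g₁, hsw₁⟩ := hW W hCM hred hsurj K hK hH hodd hd3 htors hH2 Dt β ι hβ τ hτ1 1 (Or.inl rfl)
  obtain ⟨κ₂, g₂, hsw₂⟩ := hW W hCM hred hsurj K hK hH hodd hd3 htors hH2 Dt β ι hβ τ hτ1 (-1) (Or.inr rfl)
  have hld := hLD W hCM hred hsurj K hK hH hodd hd3 htors hH2 Dt β ι hβ
  obtain ⟨r, hroom⟩ := hS W hCM hred hsurj K hK hH hodd hd3 htors hH2 Dt β ι hβ
  obtain ⟨n₁, d₁, M₁, hKol₁, hcard₁, hM₁, hidx₁, hvis₁⟩ := hroom (max (room κ₁ g₁ a₀ r) (room κ₂ g₂ a₀ r) + 1)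
  obtain ⟨hM2, hvis⟩ := hld n₁ M₁ (max (room κ₁ g₁ a₀ r) (room κ₂ g₂ a₀ r)) d₁ hM₁ hvis₁
  obtain ⟨M, rfl⟩ : ∃ M, M₁ = M + 1 := ⟨M₁ - 1, by omega⟩
  have hM : 1 ≤ M := by omega
  simp only [Nat.add_sub_cancel] at hvis
  refine ⟨r, M, hM, fun Mstar hMstar ↦ ?_⟩
  have hidxM' : ((M : ℕ) : ℕ∞) ≤ Literature.NumberTheory.EllipticCurves.Zhang2014.levelIndex W 2 n₁ :=
    le_trans (by exact_mod_cast Nat.le_succ M) hidx₁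
  obtain ⟨u, hu, hcu⟩ := hsign n₁ M d₁ hKol₁ hM hidxM'
  have hMs : M + 1 ≤ Mstar + M + 1 := by omega
  have hdeep1 : (∀ p ∈ ((1 : ℕ)).primeFactors, Mstar + M + 1 ≤ Literature.NumberTheory.EllipticCurves.Zhang2014.kolyvaginIndex W 2 p ∧ (∃ (pl : HeightOneSpectrum (𝓞 ℚ)) (𝔓 : Ideal (absIntegers (𝓞 ℚ) ℚ)) (h : absoluteGaloisGroup ℚ), (p : 𝓞 ℚ) ∈ pl.asIdeal ∧ 𝔓 ∈ pl.primesAbove ∧ IsArithFrobAt (𝓞 ℚ) h 𝔓 ∧ (∀ X : geomTorsion W ((2 ^ M : ℕ) : ℤ), h • h • X = X) ∧ ∃ P : geomTorsion W ((2 ^ M : ℕ) : ℤ), (2 : ℤ) ^ (M - 1) • (P + h • P) ≠ 0)) := fun p hp ↦ by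
    simp [Nat.primeFactors_one] at hp
  have fin : ∀ (n' : ℕ) (d' : Literature.NumberTheory.EllipticCurves.KolyvaginHeegnerData Dt β ι n'),
      Literature.NumberTheory.EllipticCurves.KolyvaginDescent.KolSupp (Literature.NumberTheory.EllipticCurves.Zhang2014.IsKolyvaginPrime (W.conductorNorm ℤ) W K 2) (n') ∧ n'.primeFactors.card = r ∧
        ((((Mstar + M + 1 : ℕ)) : ℕ) : ℕ∞) ≤ Literature.NumberTheory.EllipticCurves.Zhang2014.levelIndex W 2 n' ∧
        d'.kolyvaginClass Nat.prime_two M ≠ 0 →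
      ∃ (n : ℕ) (d : Literature.NumberTheory.EllipticCurves.KolyvaginHeegnerData Dt β ι n),
        Literature.NumberTheory.EllipticCurves.KolyvaginDescent.KolSupp (Literature.NumberTheory.EllipticCurves.Zhang2014.IsKolyvaginPrime (W.conductorNorm ℤ) W K 2) (n) ∧ n.primeFactors.card = r ∧
        ((Mstar : ℕ) : ℕ∞) ≤ Literature.NumberTheory.EllipticCurves.Zhang2014.levelIndex W 2 n ∧ d.kolyvaginClass Nat.prime_two M ≠ 0 :=
    fun n' d' h ↦ ⟨n', d', h.1, h.2.1, le_trans (by exact_mod_cast (show Mstar ≤ Mstar + M + 1 by omega)) h.2.2.1, h.2.2.2⟩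
  rcases hu with rfl | rfl
  · have hv : room κ₁ g₁ a₀ n₁.primeFactors.card ≤ max (room κ₁ g₁ a₀ r) (room κ₂ g₂ a₀ r) := by
      rw [hcard₁]; exact le_max_left _ _
    obtain ⟨t₁, ht₁⟩ := hstart M 1 hM (Or.inl rfl)
    obtain ⟨n', d', h⟩ :=
      walk W hM hMs hsw₁ n₁.primeFactors.card a₀ t₁ n₁ 1 _ n₁ d₁ (Nat.mul_one n₁).symm le_rfl hKol₁ hcard₁ hidx₁ hdeep1
        ht₁ hcu hv hvis
    exact fin n' d' h
  · have hv : room κ₂ g₂ a₀ n₁.primeFactors.card ≤ max (room κ₁ g₁ a₀ r) (room κ₂ g₂ a₀ r) := by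
      rw [hcard₁]; exact le_max_right _ _
    obtain ⟨t₂, ht₂⟩ := hstart M (-1) hM (Or.inr rfl)
    obtain ⟨n', d', h⟩ :=
      walk W hM hMs hsw₂ n₁.primeFactors.card a₀ t₂ n₁ 1 _ n₁ d₁ (Nat.mul_one n₁).symm le_rfl hKol₁ hcard₁ hidx₁ hdeep1
        ht₂ hcu hv hvis
    exact fin n' d' h

/-! ### §5 U1 ⟸ S0ʳ + SWα⁗ + P372 (the composition with SWα⁗ as a hypothesis; the plug-in of the tree theorem
`KolyvaginSwap.shedSeedPrimeShapedAtTwo_of_frobeniusCongruence` (p738438) is the one-line file `…KolyvaginSwapComposition`) -/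

/-- **U1 ⟸ S0ʳ + SWα⁗ + P372 (LINE 17 `kolyvagin_swap`, the composition, SWα⁗ kept as a hypothesis).**  CONDITIONAL: `hS` is Kolyvagin's
conjecture at 2 in room form (the line's input, `@[conjecture]`), `hα` is SWα⁗ (a tree theorem modulo P372:
`KolyvaginSwap.shedSeedPrimeShapedAtTwo_of_frobeniusCongruence`, plugged in `…KolyvaginSwapComposition`), `h37` is Gross 1991 Prop. 3.7 (2)
(named Literature fact).  LD/START/Zζ/Q2 are fed by name from the tree.  Nothing here closes the crux item or proves BSD.
[cite: Kolyvagin1991MathAnn, §2 (2.1), Conj. 2.5] [cite: GrossLMS1991, §3 Prop. 3.7 (2), §9] -/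
theorem kolyvaginBoundedDefectAtTwo_of_roomSeed_of_shedSeed (hS : KolyvaginRoomSeedAtTwo) (hα : ShedSeedPrimeShapedAtTwo)
    (h37 : Literature.NumberTheory.EllipticCurves.GrossLMS1991.prop37_2_frobeniusCongruence) : KolyvaginBoundedDefectAtTwo :=
  boundedDefect_of_deepSeed
    (deepSeedAtTwo_of_swap hS
      Summit.BirchSwinnertonDyer.BirchSwinnertonDyer.Theorems.KolyvaginAtTwo.RegularWalk.levelDropAtTwo
      Summit.BirchSwinnertonDyer.BirchSwinnertonDyer.Theorems.KolyvaginAtTwo.RegularWalk.startShapeAtTwo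
      (seedPrimeSwapShapedAtTwo_of hα
        (Summit.BirchSwinnertonDyer.BirchSwinnertonDyer.Theorems.KolyvaginAtTwo.RegularWalk.loneSeedPartnerAtTwo_of_frobeniusCongruence h37)
        (Summit.BirchSwinnertonDyer.BirchSwinnertonDyer.Theorems.GenusExact.kolyvaginRelationAtTwo_of_frobeniusCongruence h37)
        singularToVisibleAtTwo_holds))

end Summit.BirchSwinnertonDyer.BirchSwinnertonDyer.Theorems.KolyvaginAtTwo.KolyvaginSwap

end
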